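import Mathlib
import HarnessLib
import Summits.HubbardSuperconductivity.HubbardSuperconductivity.Theorems.KLProgrammeKLRegimeEngineFrameShiftResponseDoorCT

/-!
# K3 gen-8-FLOW (stmt 20437 `KLRegimeEngineV17F2`, stub (C), located «(B)-MAIN-UNPRIMED», cure «(B)-MAIN-PURE», step 1): the per-functional
# covariance-response door for the reading jets with the LOOP channel in PURE position moments — `covRespCT_readingJet_sub_le_pure`

Cell gate-hubbard-kl, seat p2 g22.  Twin of p2 g13's `…EngineFrameShiftResponseDoorCT.covRespCT_readingJet_sub_le` in which the ONE tower input `N` of the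
loop channel is asked in the PURE moment weight `(|x̃₀|+|x̃₁|)ʲ` instead of `(1+|x̃₀|+|x̃₁|)ʲ`.  WHY (KL STATUS 2026-08-28, p2 g22 «(B)-MAIN-UNPRIMED»): the
(B)-FIT interface books the derivative rows `l ≥ 1` of the frame response in the unprimed curve-jet column (`klC4aJetC2 = 2^10/2^4/2^4/2^11`), while the
door of record's MAIN group `∝ fd·N_l` is `O(U²)` at every order because the `(1+|x̃|)ˡ`-moment charges the k-INDEPENDENT tadpole response of the bare
local vertex (`𝔉⁻¹` at `x = 0`, weight `1`) — a contribution whose `l`-th momentum derivative is exactly zero.  The root lemma `norm_readingJet_le`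
(`…EngineReadingJetFunctional`) already carries the pure weight (vanishing at `x = 0` for `l ≥ 1`); it was weakened to `(1+…)ˡ` in
`norm_readingJet_le_moments` only so that one submultiplicative weight serves loop AND tree.  Here the loop keeps the pure weight (the loop lemma
`covResp_moment_kernel_two_laplacian_le_of_support` is weight-generic), the tree channel is untouched (abstract jets `A, A′` at the point):

* `norm_readingJet_le_pure_moments` — `‖Λ_{j,q,v}(G)‖ ≤ 2·(Σ_x (|x̃₀|+|x̃₁|)ʲ‖𝔉⁻¹[G](x)‖)·∏ᵢ‖vᵢ‖`;
* `sum_weight_norm_torusFourierInv_selfEnergy_laplacian_le` — the `selfEnergy`-normalised loop bound for ANY non-negative weight;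
* **`covRespCT_readingJet_sub_le_pure`** — the door with `hN` in pure moments; conclusion verbatim (`2·(2|β|L²·12·(Σ_p‖(s₁−s₀) p‖)·N) + (A + A′)/2`).

With the pure weight the natural law of `N_l` is `O(U²)·(range)ˡ` for `l ≥ 1` (the bare vertex drops; the first survivor is the one-loop correction), so the
MAIN rows `l ≥ 1` of the (B) doors built on this twin are `O(U³)`.  Proofs only; nothing about `N`, `A`, `Z_t` or the sizes of `𝒲` is asserted; nothing
asserts superconductivity.  References: Salmhofer 1998 §3.1 Prop. 1; BGM 2006 §2.3 (2.17), §3 (3.3) [cite: BenfattoGiulianiMastropietro2006]; FST 1996 §1.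
-/

noncomputable section

namespace Summit.HubbardSuperconductivity.HubbardSuperconductivity.Theorems.EngineV8

set_option linter.dupNamespace false -- summit = problem name (single-conjunct summit), D-0017

open Finset Literature.MathematicalPhysics.QuantumLattice Literature.Probability.LatticeModels GrassmannAlgebra
open Summit.HubbardSuperconductivity.HubbardSuperconductivity.Theorems.KLRegimeSplit
open Summit.HubbardSuperconductivity.HubbardSuperconductivity.Theorems.TwoVolumeDefect

variable {L M : ℕ} [NeZero L]

/-! ## §1 The reading-jet functional by PURE moments -/

/-- **`‖Λ_{j,q,v}(G)‖ ≤ 2·(Σ_x (|x̃₀|+|x̃₁|)ʲ‖𝔉⁻¹[G](x)‖)·∏ᵢ‖vᵢ‖`** — `norm_readingJet_le_moments` without the last weakening `(|x̃₀|+|x̃₁|)ʲ ≤ (1+|x̃₀|+|x̃₁|)ʲ`.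
[cite: BenfattoGiulianiMastropietro2006, §2.3 (2.17)] -/
theorem norm_readingJet_le_pure_moments (G : TorusSite 2 L → ℂ) (j : ℕ) (q : Momentum) (v : Fin j → Momentum) :
    ‖∑ x : TorusSite 2 L, ((torusCosCoeff L (fun k => (G k).re) x : ℂ) + (torusCosCoeff L (fun k => (G k).im) x : ℂ) * Complex.I) *
        ((iteratedFDeriv ℝ j (fun q : Momentum => TrigPolyC4v.harmonic (x 0).valMinAbs.natAbs (x 1).valMinAbs.natAbs (WithLp.ofLp q)) q v : ℝ) :
          ℂ)‖ ≤
      2 * (∑ x : TorusSite 2 L, (((x 0).valMinAbs.natAbs : ℝ) + ((x 1).valMinAbs.natAbs : ℝ)) ^ j * ‖torusFourierInv G x‖) * ∏ i, ‖v i‖ := by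
  refine (norm_readingJet_le G j q v).trans (mul_le_mul_of_nonneg_right ?_ (Finset.prod_nonneg fun i _ => norm_nonneg _))
  set w : TorusSite 2 L → ℝ := fun x => (((x 0).valMinAbs.natAbs : ℝ) + ((x 1).valMinAbs.natAbs : ℝ)) ^ j with hw
  have hw0 : ∀ x, 0 ≤ w x := fun x => by rw [hw]; positivity
  have hwe : ∀ x, w (-x) = w x := fun x => by
    simp only [hw, Pi.neg_apply, ZMod.natAbs_valMinAbs_neg]
  exact sum_mul_norm_cosCoeffC_le G hw0 hwe

/-- **The loop bound in the `selfEnergy` normalisation for ANY non-negative weight**: `Σ_x w(x)‖𝔉⁻¹[k⃗ ↦ Σ[Δ_{ṡ}𝒲]((ω_i,k⃗),σ)](x)‖ ≤ 2|β|L²·12·(Σ_p‖ṡ p‖)·N`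
from the `w`-moments `≤ N` of the four-leg data at the loop strings over the support of `ṡ`. [cite: BenfattoGiulianiMastropietro2006, §3 (3.3)] -/
theorem sum_weight_norm_torusFourierInv_selfEnergy_laplacian_le (sdot : FreqMomentum L M × Fin 2 → ℂ) (W : HubbardGrassmann L M) (β : ℝ)
    (i : MatsubaraIdx M) (σ : Fin 2) {w : TorusSite 2 L → ℝ} (hw0 : ∀ x, 0 ≤ w x) {N : ℝ} (hN0 : 0 ≤ N)
    (hN : ∀ A : HubbardFieldIdx L M, sdot A.1 ≠ 0 → ∑ x : TorusSite 2 L, w x *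
      ‖torusFourierInv (fun kv : TorusSite 2 L =>
        kernel ℂ W 4 (Fin.snoc (Fin.snoc ![((((i, kv), σ), 0) : HubbardFieldIdx L M), (((i, kv), σ), 1)] (A.1, 1 - A.2) :
          Fin 3 → HubbardFieldIdx L M) A)) x‖ ≤ N) :
    ∑ x : TorusSite 2 L, w x *
        ‖torusFourierInv (fun kv : TorusSite 2 L => selfEnergy L M β (grassmannLaplacian ℂ (normalCovariance L M sdot) W) (i, kv) σ) x‖ ≤
      2 * (|β| * (L : ℝ) ^ 2) * (12 * (∑ p, ‖sdot p‖) * N) := by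
  have h := covResp_moment_kernel_two_laplacian_le_of_support sdot W i σ hw0 hN0 hN
  simp_rw [selfEnergy_eq_const_mul_kernel, torusFourierInv_const_mul, norm_mul, norm_selfEnergy_const]
  calc ∑ x : TorusSite 2 L, w x * (2 * (|β| * (L : ℝ) ^ 2) *
        ‖torusFourierInv (fun kv : TorusSite 2 L => kernel ℂ (grassmannLaplacian ℂ (normalCovariance L M sdot) W) 2
          ![((((i, kv), σ), 0) : HubbardFieldIdx L M), (((i, kv), σ), 1)]) x‖)
      = 2 * (|β| * (L : ℝ) ^ 2) * ∑ x : TorusSite 2 L, w x *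
        ‖torusFourierInv (fun kv : TorusSite 2 L => kernel ℂ (grassmannLaplacian ℂ (normalCovariance L M sdot) W) 2
          ![((((i, kv), σ), 0) : HubbardFieldIdx L M), (((i, kv), σ), 1)]) x‖ := by
        rw [mul_sum]; exact sum_congr rfl fun x _ => by ring
    _ ≤ 2 * (|β| * (L : ℝ) ^ 2) * (12 * (∑ p, ‖sdot p‖) * N) := mul_le_mul_of_nonneg_left h (by positivity)

/-! ## §2 The per-functional door with the loop in pure moments -/

/-- **THE COVARIANCE-RESPONSE DOOR FOR THE READING JETS, PURE LOOP MOMENTS** (vertex `V_U + 𝒩_K`, symbols `s₀ → s₁`, reading frequencies `ω₊, ω₋`).  Along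
`C_t = normalCovariance (s₀ + t(s₁ − s₀))` with `Z_t ≠ 0`: if for every `t ∈ [0,1]` the PURE `(|x̃₀|+|x̃₁|)ʲ`-moments of the four-leg data of `𝒲_t` at the loop
strings `(K σ 0)(K σ 1)(Ā)(A)` are `≤ N` for every loop label `A` in the support of `s₁ − s₀` (both reading frequencies, both spins), and the `j`-th momentum jets
AT `q` of the interpolated real and imaginary parts of the TREE data `¼Σ_σ[Σ[(𝒲_t,𝒲_t)_{s₁−s₀}](ω_±,·,σ)]` are `≤ A` and `≤ A′`, then
`‖Dʲ[evalM (symInterp L (¼Σ_σ[Re Σ[𝒲′[s₁]](ω_±,·,σ)] − ¼Σ_σ[Re Σ[𝒲′[s₀]](ω_±,·,σ)]))](q)‖ ≤ 2·(2|β|L²·12·(Σ_p‖(s₁−s₀) p‖)·N) + (A + A′)/2`. -/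
theorem covRespCT_readingJet_sub_le_pure (s₀ s₁ : FreqMomentum L M × Fin 2 → ℂ) (β U : ℝ) (K : TrigPolyC4v) (ip im : MatsubaraIdx M)
    (j : ℕ) (q : Momentum)
    (hZ : ∀ t ∈ Set.Icc (0 : ℝ) 1, effPartitionFn ℂ (normalCovariance L M s₀ + ((t : ℂ)) • (normalCovariance L M s₁ - normalCovariance L M s₀))
      (hubbardInteraction L M β U + counterQuadratic L M β K) ≠ 0)
    {N A A' : ℝ} (hN0 : 0 ≤ N) (hA0 : 0 ≤ A) (hA0' : 0 ≤ A')
    (hN : ∀ t ∈ Set.Icc (0 : ℝ) 1, ∀ i ∈ ({ip, im} : Finset (MatsubaraIdx M)), ∀ σ : Fin 2, ∀ A : HubbardFieldIdx L M, s₁ A.1 - s₀ A.1 ≠ 0 →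
      ∑ x : TorusSite 2 L, (((x 0).valMinAbs.natAbs : ℝ) + ((x 1).valMinAbs.natAbs : ℝ)) ^ j * ‖torusFourierInv (fun kv : TorusSite 2 L =>
        kernel ℂ (effAction ℂ (normalCovariance L M s₀ + ((t : ℂ)) • (normalCovariance L M s₁ - normalCovariance L M s₀))
          (hubbardInteraction L M β U + counterQuadratic L M β K)) 4
          (Fin.snoc (Fin.snoc ![((((i, kv), σ), 0) : HubbardFieldIdx L M), (((i, kv), σ), 1)] (A.1, 1 - A.2) : Fin 3 → HubbardFieldIdx L M) A)) x‖ ≤ N)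
    (hT : ∀ t ∈ Set.Icc (0 : ℝ) 1,
      ‖iteratedFDeriv ℝ j (evalM (symInterp L (fun kv : TorusSite 2 L => ((∑ σ : Fin 2,
        (selfEnergy L M β (grassmannDerivPairing ℂ (normalCovariance L M s₁ - normalCovariance L M s₀)
            (effAction ℂ (normalCovariance L M s₀ + ((t : ℂ)) • (normalCovariance L M s₁ - normalCovariance L M s₀))
              (hubbardInteraction L M β U + counterQuadratic L M β K))
            (effAction ℂ (normalCovariance L M s₀ + ((t : ℂ)) • (normalCovariance L M s₁ - normalCovariance L M s₀))
              (hubbardInteraction L M β U + counterQuadratic L M β K))) (ip, kv) σ +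
          selfEnergy L M β (grassmannDerivPairing ℂ (normalCovariance L M s₁ - normalCovariance L M s₀)
            (effAction ℂ (normalCovariance L M s₀ + ((t : ℂ)) • (normalCovariance L M s₁ - normalCovariance L M s₀))
              (hubbardInteraction L M β U + counterQuadratic L M β K))
            (effAction ℂ (normalCovariance L M s₀ + ((t : ℂ)) • (normalCovariance L M s₁ - normalCovariance L M s₀))
              (hubbardInteraction L M β U + counterQuadratic L M β K))) (im, kv) σ)) / 4).re))) q‖ ≤ A ∧
      ‖iteratedFDeriv ℝ j (evalM (symInterp L (fun kv : TorusSite 2 L => ((∑ σ : Fin 2,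
        (selfEnergy L M β (grassmannDerivPairing ℂ (normalCovariance L M s₁ - normalCovariance L M s₀)
            (effAction ℂ (normalCovariance L M s₀ + ((t : ℂ)) • (normalCovariance L M s₁ - normalCovariance L M s₀))
              (hubbardInteraction L M β U + counterQuadratic L M β K))
            (effAction ℂ (normalCovariance L M s₀ + ((t : ℂ)) • (normalCovariance L M s₁ - normalCovariance L M s₀))
              (hubbardInteraction L M β U + counterQuadratic L M β K))) (ip, kv) σ +
          selfEnergy L M β (grassmannDerivPairing ℂ (normalCovariance L M s₁ - normalCovariance L M s₀)
            (effAction ℂ (normalCovariance L M s₀ + ((t : ℂ)) • (normalCovariance L M s₁ - normalCovariance L M s₀))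
              (hubbardInteraction L M β U + counterQuadratic L M β K))
            (effAction ℂ (normalCovariance L M s₀ + ((t : ℂ)) • (normalCovariance L M s₁ - normalCovariance L M s₀))
              (hubbardInteraction L M β U + counterQuadratic L M β K))) (im, kv) σ)) / 4).im))) q‖ ≤ A') :
    ‖iteratedFDeriv ℝ j (evalM (symInterp L (fun kv : TorusSite 2 L =>
        (∑ σ : Fin 2, ((selfEnergy L M β (effAction ℂ (normalCovariance L M s₁) (hubbardInteraction L M β U + counterQuadratic L M β K)) (ip, kv) σ).re +
          (selfEnergy L M β (effAction ℂ (normalCovariance L M s₁) (hubbardInteraction L M β U + counterQuadratic L M β K)) (im, kv) σ).re)) / 4 -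
        (∑ σ : Fin 2, ((selfEnergy L M β (effAction ℂ (normalCovariance L M s₀) (hubbardInteraction L M β U + counterQuadratic L M β K)) (ip, kv) σ).re +
          (selfEnergy L M β (effAction ℂ (normalCovariance L M s₀) (hubbardInteraction L M β U + counterQuadratic L M β K)) (im, kv) σ).re)) / 4))) q‖ ≤
      2 * (2 * (|β| * (L : ℝ) ^ 2) * (12 * (∑ p, ‖s₁ p - s₀ p‖) * N)) + (A + A') / 2 := by
  classical
  letI : LinearOrder (HubbardFieldIdx L M) := LinearOrder.lift' (Fintype.equivFin _) (Fintype.equivFin _).injective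
  set V := hubbardInteraction L M β U + counterQuadratic L M β K with hV
  -- the complex averaged reading data of a Grassmann element
  set G : HubbardGrassmann L M → TorusSite 2 L → ℂ := fun W kv =>
    (∑ σ : Fin 2, (selfEnergy L M β W (ip, kv) σ + selfEnergy L M β W (im, kv) σ)) / 4 with hG
  have hGadd : ∀ W W' : HubbardGrassmann L M, G (W + W') = fun kv => G W kv + G W' kv := fun W W' => by
    funext kv
    simp only [hG, selfEnergy_add', Fin.sum_univ_two]
    ring
  have hGsmul : ∀ (c : ℂ) (W : HubbardGrassmann L M), G (c • W) = fun kv => c * G W kv := fun c W => by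
    funext kv
    simp only [hG, selfEnergy_smul', Fin.sum_univ_two]
    ring
  have hG1 : G 1 = fun _ => 0 := by
    funext kv
    simp only [hG, selfEnergy_one, Fin.sum_univ_two, add_zero, zero_div]
  have hGsub : ∀ W W' : HubbardGrassmann L M, G (W - W') = fun kv => G W kv - G W' kv := fun W W' => by
    rw [sub_eq_add_neg, hGadd, ← neg_one_smul ℂ W', hGsmul]
    funext kv; ring
  -- the real part of the endpoint-difference data IS the reading data of the statement
  set W₁ := effAction ℂ (normalCovariance L M s₁) V with hW₁
  set W₀ := effAction ℂ (normalCovariance L M s₀) V with hW₀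
  have hre : (fun kv : TorusSite 2 L =>
        (∑ σ : Fin 2, ((selfEnergy L M β W₁ (ip, kv) σ).re + (selfEnergy L M β W₁ (im, kv) σ).re)) / 4 -
        (∑ σ : Fin 2, ((selfEnergy L M β W₀ (ip, kv) σ).re + (selfEnergy L M β W₀ (im, kv) σ).re)) / 4) =
      fun kv => (G (W₁ - W₀) kv).re := by
    funext kv
    rw [hGsub]
    simp only [hG, Fin.sum_univ_two, Complex.sub_re, Complex.div_ofNat_re, Complex.add_re]
  rw [hre]
  -- the bound constant
  set Bl : ℝ := 2 * (|β| * (L : ℝ) ^ 2) * (12 * (∑ p, ‖s₁ p - s₀ p‖) * N) with hBl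
  have hBl0 : 0 ≤ Bl := by rw [hBl]; positivity
  refine norm_iteratedFDeriv_evalM_symInterp_re_le_of_readingJet (G (W₁ - W₀)) j q (by positivity) fun v => ?_
  -- the fixed ℂ-linear functional: the reading jet of the averaged data
  let Φ : HubbardGrassmann L M →ₗ[ℂ] ℂ :=
    { toFun := fun W => ∑ x : TorusSite 2 L, ((torusCosCoeff L (fun k => (G W k).re) x : ℂ) + (torusCosCoeff L (fun k => (G W k).im) x : ℂ) * Complex.I) *
        ((iteratedFDeriv ℝ j (fun q : Momentum => TrigPolyC4v.harmonic (x 0).valMinAbs.natAbs (x 1).valMinAbs.natAbs (WithLp.ofLp q)) q v : ℝ) : ℂ)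
      map_add' := fun W W' => by
        have h := readingJet_add (G W) (G W') j q v
        rw [hGadd]
        exact h
      map_smul' := fun c W => by
        have h := readingJet_smul c (G W) j q v
        rw [RingHom.id_apply, smul_eq_mul, hGsmul]
        exact h }
  have hΦapply : ∀ W, Φ W = ∑ x : TorusSite 2 L, ((torusCosCoeff L (fun k => (G W k).re) x : ℂ) + (torusCosCoeff L (fun k => (G W k).im) x : ℂ) * Complex.I) *
        ((iteratedFDeriv ℝ j (fun q : Momentum => TrigPolyC4v.harmonic (x 0).valMinAbs.natAbs (x 1).valMinAbs.natAbs (WithLp.ofLp q)) q v : ℝ) : ℂ) :=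
    fun W => rfl
  have hΦ1 : Φ 1 = 0 := by
    have h := readingJet_smul 0 (G 1) j q v
    rw [zero_mul] at h
    rw [hΦapply, ← h, hG1]
    simp
  -- endpoint difference = the reading jet of the difference data
  have hdiff : Φ W₁ - Φ W₀ = ∑ x : TorusSite 2 L, ((torusCosCoeff L (fun k => (G (W₁ - W₀) k).re) x : ℂ) +
        (torusCosCoeff L (fun k => (G (W₁ - W₀) k).im) x : ℂ) * Complex.I) *
        ((iteratedFDeriv ℝ j (fun q : Momentum => TrigPolyC4v.harmonic (x 0).valMinAbs.natAbs (x 1).valMinAbs.natAbs (WithLp.ofLp q)) q v : ℝ) : ℂ) := by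
    rw [← map_sub, hΦapply]
  rw [← hdiff]
  have hV0 := constPart_hubbardInteraction_add_counterQuadratic (L := L) (M := M) β U K
  have hVe : V ∈ evenOdd ℂ (ι := HubbardFieldIdx L M) 0 := hubbardInteraction_add_counterQuadratic_mem_evenOdd_zero β U K
  refine norm_apply_effAction_sub_le_of_linePath (normalCovariance L M s₀) (normalCovariance L M s₁) hV0 hVe hZ Φ hΦ1 ?_
  intro t ht
  have hNt := hN t ht
  have hTt := hT t ht
  set Wt := effAction ℂ (normalCovariance L M s₀ + ((t : ℂ)) • (normalCovariance L M s₁ - normalCovariance L M s₀)) V with hWt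
  -- LOOP: moments of the averaged Laplacian data, support-restricted four-leg hypothesis
  have hloop : ‖Φ (grassmannLaplacian ℂ (normalCovariance L M s₁ - normalCovariance L M s₀) Wt)‖ ≤ 2 * Bl * ∏ i, ‖v i‖ := by
    rw [hΦapply]
    refine (norm_readingJet_le_pure_moments _ j q v).trans ?_
    have hw0 : ∀ x : TorusSite 2 L, 0 ≤ (((x 0).valMinAbs.natAbs : ℝ) + ((x 1).valMinAbs.natAbs : ℝ)) ^ j := fun x => by positivity
    have hmom : ∑ x : TorusSite 2 L, (((x 0).valMinAbs.natAbs : ℝ) + ((x 1).valMinAbs.natAbs : ℝ)) ^ j *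
        ‖torusFourierInv (G (grassmannLaplacian ℂ (normalCovariance L M s₁ - normalCovariance L M s₀) Wt)) x‖ ≤ Bl := by
      rw [normalCovariance_sub]
      refine sum_mul_norm_torusFourierInv_locAvg_le hw0
        (fun σ kv => selfEnergy L M β (grassmannLaplacian ℂ (normalCovariance L M fun p => s₁ p - s₀ p) Wt) (ip, kv) σ)
        (fun σ kv => selfEnergy L M β (grassmannLaplacian ℂ (normalCovariance L M fun p => s₁ p - s₀ p) Wt) (im, kv) σ) ?_ ?_
      · exact fun σ => sum_weight_norm_torusFourierInv_selfEnergy_laplacian_le (fun p => s₁ p - s₀ p) Wt β ip σ hw0 hN0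
          (fun A hA => hNt ip (by simp) σ A hA)
      · exact fun σ => sum_weight_norm_torusFourierInv_selfEnergy_laplacian_le (fun p => s₁ p - s₀ p) Wt β im σ hw0 hN0
          (fun A hA => hNt im (by simp) σ A hA)
    exact mul_le_mul_of_nonneg_right (mul_le_mul_of_nonneg_left hmom (by norm_num)) (Finset.prod_nonneg fun i _ => norm_nonneg _)
  -- TREE: the sup-route hypothesis on the real and imaginary jets of the pairing data
  have htree : ‖Φ (grassmannDerivPairing ℂ (normalCovariance L M s₁ - normalCovariance L M s₀) Wt Wt)‖ ≤ (A + A') * ∏ i, ‖v i‖ := by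
    rw [hΦapply]
    exact norm_readingJet_le_of_jets _ j q v hTt.1 hTt.2
  calc ‖Φ (grassmannLaplacian ℂ (normalCovariance L M s₁ - normalCovariance L M s₀) Wt) -
        (2 : ℂ)⁻¹ * Φ (grassmannDerivPairing ℂ (normalCovariance L M s₁ - normalCovariance L M s₀) Wt Wt)‖
      ≤ ‖Φ (grassmannLaplacian ℂ (normalCovariance L M s₁ - normalCovariance L M s₀) Wt)‖ +
          ‖(2 : ℂ)⁻¹ * Φ (grassmannDerivPairing ℂ (normalCovariance L M s₁ - normalCovariance L M s₀) Wt Wt)‖ := norm_sub_le _ _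
    _ ≤ 2 * Bl * ∏ i, ‖v i‖ + 2⁻¹ * ((A + A') * ∏ i, ‖v i‖) := by
        refine add_le_add hloop ?_
        rw [norm_mul, norm_inv, RCLike.norm_ofNat]
        exact mul_le_mul_of_nonneg_left htree (by norm_num)
    _ = (2 * Bl + (A + A') / 2) * ∏ i, ‖v i‖ := by ring

end Summit.HubbardSuperconductivity.HubbardSuperconductivity.Theorems.EngineV8

end
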